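import Mathlib.GroupTheory.SpecificGroups.Dihedral
import Mathlib.Tactic.Linarith
import Summits.MatrixMultiplication.OmegaCensus.DihedralLawAttainedCyclic
import HarnessLib

/-!
# `β(C₂ × D_{2k}) < β(D_{4k})` for `k ≡ 4 (mod 6)`, `k ≥ 10`

ω-census, family (b3).  Framing: lottery ticket; floor = certified bounds/negative ranges.

A concrete instance of `DihedralLawAttainedCyclic.lean`: the group `C₂ × D_{2k}`
(`Multiplicative (ZMod 2) × DihedralGroup k`) is the generalized dihedral group of `A = ℤ₂ × ℤ_k`, which is not
cyclic when `k` is even.  Hence for `k` even, `k ≡ 1 (mod 3)` (`|A| = 2k ≡ 2 (mod 3)`), `k ≥ 7`: every TPP triple has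
`3|S||T||U| + 7 ≤ 16k` (`tpp_volume_lt_law_c2_dihedral`), whereas the dihedral group `D_{4k}` of the same order
attains `3|S||T||U| + 4 = 16k` (`dihedral_law` at `n = 2k`).  Smallest cases: `β(C₂ × D₂₀) ≤ 51 < 52 = β(D₄₀)`
(census value `48`, search), `β(C₂ × D₃₂) ≤ 83 < 84 = β(D₆₄)`.
-/

namespace Summit.MatrixMultiplication.OmegaCensus

open Literature.Combinatorics.Additive Finset

/-- `ℤ₂ × ℤ_k` is not cyclic for even `k`. [folklore] -/
theorem not_cyclic_zmod_two_prod {k : ℕ} [NeZero k] (hk : 2 ∣ k) :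
    ¬ ∃ g : ZMod 2 × ZMod k, ∀ x, x ∈ AddSubgroup.zmultiples g := by
  rintro ⟨g, hg⟩
  have htop : AddSubgroup.zmultiples g = ⊤ := (AddSubgroup.eq_top_iff' _).2 hg
  have hcard : addOrderOf g = 2 * k := by
    rw [← Nat.card_zmultiples, htop, AddSubgroup.card_top, Nat.card_eq_fintype_card, Fintype.card_prod,
      ZMod.card, ZMod.card]
  have hk0 : k • g = 0 := by
    obtain ⟨a, i⟩ := g
    rw [Prod.smul_mk, Prod.mk_eq_zero, nsmul_eq_mul, nsmul_eq_mul, ZMod.natCast_self, zero_mul,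
      (ZMod.natCast_eq_zero_iff k 2).2 hk, zero_mul]
    exact ⟨rfl, rfl⟩
  have hdvd := addOrderOf_dvd_of_nsmul_eq_zero hk0
  rw [hcard] at hdvd
  have hkpos : 0 < k := Nat.pos_of_ne_zero (NeZero.ne k)
  have := Nat.le_of_dvd hkpos hdvd
  omega

/-- **`3|S||T||U| + 7 ≤ 16k` for every TPP triple of `C₂ × D_{2k}`, `k` even, `k ≡ 1 (mod 3)`, `k ≥ 7`** (whereas
`D_{4k}` attains `3|S||T||U| + 4 = 16k`). [folklore] -/
theorem tpp_volume_lt_law_c2_dihedral {k : ℕ} [NeZero k] (hk2 : 2 ∣ k) (hk3 : k % 3 = 1) (hk7 : 7 ≤ k)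
    {S T U : Finset (Multiplicative (ZMod 2) × DihedralGroup k)} (h : TripleProductProperty S T U) :
    3 * (S.card * T.card * U.card) + 7 ≤ 16 * k := by
  have key := tpp_volume_lt_law_of_not_cyclic (A := ZMod 2 × ZMod k)
    (ρ := fun p : ZMod 2 × ZMod k => (Multiplicative.ofAdd p.1, DihedralGroup.r p.2))
    (τ := fun p : ZMod 2 × ZMod k => (Multiplicative.ofAdd p.1, DihedralGroup.sr p.2)) (c₀ := (0 : ZMod 2 × ZMod k))
    (fun a b => by
      simp only [Prod.mk_mul_mk, DihedralGroup.r_mul_r, ← ofAdd_add, Prod.fst_add, Prod.snd_add])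
    (fun a b => by
      simp only [Prod.mk_mul_mk, DihedralGroup.r_mul_sr, ← ofAdd_add, Prod.fst_sub, Prod.snd_sub]
      rw [sub_eq_add_neg b.1, ZMod.neg_eq_self_mod_two, add_comm b.1])
    (fun a b => by
      simp only [Prod.mk_mul_mk, DihedralGroup.sr_mul_r, ← ofAdd_add, Prod.fst_add, Prod.snd_add])
    (fun a b => by
      simp only [Prod.mk_mul_mk, DihedralGroup.sr_mul_sr, ← ofAdd_add, zero_add, Prod.fst_sub, Prod.snd_sub]
      rw [sub_eq_add_neg b.1, ZMod.neg_eq_self_mod_two, add_comm b.1])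
    (fun a b hab => by
      simp only [Prod.mk.injEq, DihedralGroup.r.injEq] at hab
      exact Prod.ext (Multiplicative.ofAdd.injective hab.1) hab.2)
    (fun a b hab => by
      simp only [Prod.mk.injEq, DihedralGroup.sr.injEq] at hab
      exact Prod.ext (Multiplicative.ofAdd.injective hab.1) hab.2)
    (fun a b hab => by simp at hab)
    (fun g => by
      obtain ⟨m, d⟩ := g
      cases d with
      | r i => exact Or.inl ⟨(Multiplicative.toAdd m, i), rfl⟩
      | sr i => exact Or.inr ⟨(Multiplicative.toAdd m, i), rfl⟩)
    (by rw [Fintype.card_prod, ZMod.card, ZMod.card]; omega)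
    (by rw [Fintype.card_prod, ZMod.card, ZMod.card]; omega)
    (by rw [Fintype.card_prod, ZMod.card, ZMod.card]; omega)
    (not_cyclic_zmod_two_prod hk2) h
  rw [Fintype.card_prod, ZMod.card, ZMod.card] at key
  omega

end Summit.MatrixMultiplication.OmegaCensus
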